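import Summits.ResolutionOfSingularities.ResolutionOfSingularities.Theorems.WeightedInvariantKeyRungThreeOfGame
import Summits.ResolutionOfSingularities.ResolutionOfSingularities.Theorems.WeightedInvariantContactCylinderStratumLocalizeFlatT
import Summits.ResolutionOfSingularities.ResolutionOfSingularities.Theorems.WeightedInvariantIota3JFlatOver
import HarnessLib

/-!
# The CENTRE HALF of hgame `CanonicalGameClauseHomLE 3 p ι₃ᵗ J₃ᵗ` DISCHARGED: the canonical centre of the pair `(ι₃ᵗ, J₃ᵗ)` is the
# top `ι₀`-stratum prime; gap list of `stub_keyRungGrHomLE_three` = hD, (presentation + drop at that centre)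
# (door `HypersurfaceCentreConstruction`, stmt-ResolutionOfSingularities-19897)

Helper for `stub_keyRungGrHomLE_three` (def-free, `--supports 19897`).  Sequel of …KeyRungThreeOfGame (gap list hD, hgame).  The clause
hgame asks, at every regular local `S` of the door setting with `dim S ≤ 3` and `0 ≠ f ∈ 𝔪²`, for a prime `P ∋ f` with `S ⧸ P` regular such that
(i) `ι₃ᵗ` is stationary at `S_𝔭` exactly for `𝔭 ⊇ P`, (ii) `J₃ᵗ` localises along `V(P)`, and (iii) a weighted regular system of parameters
presents `P` and `J₃ᵗ`, keeps `f` in `𝔪_Q²` along `V(P)`, and makes `ι₃ᵗ` drop at the `t`-homogeneous points of the weighted blow-up.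
**`Iota3.exists_canonicalCentre_iotaFlatT`** proves (i) and (ii) OUTRIGHT for every regular local `S` of Krull dimension `≤ 3` and every
`0 ≠ f ∈ 𝔪`, with `P` = the generic prime of the top `ι₀ = (ν ; ε ; τ)`-stratum ((strat-τ) `Iota3.topStratum_iotaOrdEpsTau_eq`:
`P` prime, `S ⧸ P` regular, `f ∈ P`, `topStratum ι₀ S f = V(P)`; `ι₃ᵗ = iotaLex ι₀ (cylinder σ)` is stationary at `S_𝔭` iff `ι₀` is
(`iotaFlatT_eq_iff`, `ContactCylinder.iotaCylinder_localization_eq`), i.e. iff `P ≤ 𝔭`; `J₃ᵗ = jCylinder ι₀ jFlatCoreE` localises by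
`ContactCylinder.jCylinder_localization`).  Hence **`canonicalGameClauseHomLE_three_of_presentation`**: hgame ⟸ (iii) AT THIS `P`, and the
GAP LIST OF RECORD **`keyRungGrHomLE_three_of_drop`**: `KeyRungGrHomLE 3 p` from hD (typing item) and hdrop = «weighted presentation of
`(P, J₃ᵗ)` + `f ∈ 𝔪_Q²` on `V(P)` + `WeightedDropHom ι₃ᵗ S f P u w` at the top-`ι₀`-stratum prime `P`».
[OURS · L1 W4.3 · audit glue + (c7-cyl) equality form; AI work, weaker than expert review; nothing here is a statement of the manuscript under review.]
-/

noncomputable section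

set_option linter.dupNamespace false -- mandated namespace of this single-conjunct summit

open IsLocalRing Literature.AlgebraicGeometry.Resolution
open Summit.ResolutionOfSingularities.ResolutionOfSingularities.Theorems
open Summit.ResolutionOfSingularities.ResolutionOfSingularities.Theorems.ContactCylinder

namespace Summit.ResolutionOfSingularities.ResolutionOfSingularities.Cruxes.HypersurfaceCentreConstruction.LocalEngine

namespace Iota3

/-- **THE CANONICAL CENTRE OF `(ι₃ᵗ, J₃ᵗ)`** at a regular local ring `S` of Krull dimension `≤ 3`, `0 ≠ f ∈ 𝔪`: the generic prime `P` of the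
top `ι₀`-stratum is prime with `S ⧸ P` regular and `f ∈ P`; `ι₃ᵗ (S_𝔭) (f/1) = ι₃ᵗ S f ↔ P ≤ 𝔭` for every prime `𝔭`; and
`J₃ᵗ (S_𝔭) (f/1) m = J₃ᵗ S f m · S_𝔭` for every prime `𝔭 ⊇ P`.  (Conjuncts (i), (ii) of `CanonicalGameClauseHomLE 3 p iotaFlatT jFlatT`.)
[OURS · L1 W4.3 · (strat-τ) + (c7-cyl) equality form] -/
theorem exists_canonicalCentre_iotaFlatT (S : Type) [CommRing S] [IsRegularLocalRing S] (hdim : ringKrullDim S ≤ 3)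
    {f : S} (hf0 : f ≠ 0) (hf : f ∈ maximalIdeal S) :
    ∃ P : Ideal S, P.IsPrime ∧ IsRegularLocalRing (S ⧸ P) ∧ f ∈ P ∧
      topStratum iotaOrdEpsTau S f = {𝔮 | P ≤ 𝔮.asIdeal} ∧
      (∀ (𝔭 : Ideal S) [𝔭.IsPrime],
        iotaFlatT (Localization.AtPrime 𝔭) (algebraMap S (Localization.AtPrime 𝔭) f) = iotaFlatT S f ↔ P ≤ 𝔭) ∧
      (∀ (𝔭 : Ideal S) [𝔭.IsPrime], P ≤ 𝔭 → ∀ m : ℕ,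
        jFlatT (Localization.AtPrime 𝔭) (algebraMap S (Localization.AtPrime 𝔭) f) m =
          (jFlatT S f m).map (algebraMap S (Localization.AtPrime 𝔭))) := by
  obtain ⟨P, hP, hreg, hfP, hE⟩ := topStratum_iotaOrdEpsTau_eq hdim hf0 hf
  haveI := hP
  refine ⟨P, hP, hreg, hfP, hE, fun 𝔭 _ => ⟨fun h => ?_, fun h𝔭 => ?_⟩, fun 𝔭 _ h𝔭 m => ?_⟩
  · have h0 := ((iotaFlatT_eq_iff _ _ _ _).mp h).1
    have hmem : (⟨𝔭, ‹_›⟩ : PrimeSpectrum S) ∈ topStratum iotaOrdEpsTau S f := h0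
    rw [hE] at hmem
    exact hmem
  · rw [iotaFlatT_eq_iff]
    exact ⟨iota_localization_eq_of_topStratum_eq S P 𝔭 h𝔭 f hE,
      iotaCylinder_localization_eq iotaOrdEpsTau_isoInvariant iotaSigma_isoInvariant S P 𝔭 h𝔭 f hE⟩
  · exact jCylinder_localization iotaOrdEpsTau_isoInvariant jFlatCoreE_isoInvariant S P 𝔭 h𝔭 f hE m

end Iota3

open Iota3

/-- **hgame ⟸ its PRESENTATION-AND-DROP conjunct at the canonical centre.**  `CanonicalGameClauseHomLE 3 p iotaFlatT jFlatT` follows from: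
for every `S`, `f` of the clause and every prime `P` with `S ⧸ P` regular, `f ∈ P` and `topStratum ι₀ S f = V(P)`, a weighted regular system of
parameters `(u, w)` presenting `P` and `J₃ᵗ`, with `f ∈ 𝔪_Q²` along `V(P)` and `WeightedDropHom iotaFlatT S f P u w` (conjuncts (i), (ii) by
`exists_canonicalCentre_iotaFlatT`). [OURS · L1 W4.3 · audit glue] -/
theorem canonicalGameClauseHomLE_three_of_presentation (p : ℕ)
    (hdrop : ∀ (k₀ : Type) [Field k₀] [CharP k₀ p] [PerfectField k₀]
      (S : Type) [CommRing S] [Algebra k₀ S] [Algebra.EssFiniteType k₀ S] [IsRegularLocalRing S]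
      (f : S), ringKrullDim S ≤ 3 → f ≠ 0 → f ∈ (maximalIdeal S) ^ 2 →
      ∀ (P : Ideal S) [P.IsPrime], IsRegularLocalRing (S ⧸ P) → f ∈ P →
        topStratum iotaOrdEpsTau S f = {𝔮 | P ≤ 𝔮.asIdeal} →
        ∃ (n : ℕ) (u : Fin n → S) (w : Fin n → ℕ),
          Ideal.span (Set.range u) = maximalIdeal S ∧ (maximalIdeal S).spanFinrank = n ∧ (∃ i, 0 < w i) ∧
          Ideal.span {x | ∃ i, 0 < w i ∧ x = u i} = P ∧
          (∀ m : ℕ, weightedMonomialIdeal u w m = jFlatT S f m) ∧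
          (∀ (Q : Ideal S) [Q.IsPrime], P ≤ Q →
            algebraMap S (Localization.AtPrime Q) f ∈ (maximalIdeal (Localization.AtPrime Q)) ^ 2) ∧
          WeightedDropHom iotaFlatT S f P u w) :
    CanonicalGameClauseHomLE 3 p iotaFlatT jFlatT := by
  intro k₀ _ _ _ S _ _ _ _ f hd hf0 hf2
  have hf : f ∈ maximalIdeal S := Ideal.pow_le_self two_ne_zero hf2
  obtain ⟨P, hP, hreg, hfP, hE, hι, hJ⟩ := exists_canonicalCentre_iotaFlatT S hd hf0 hf
  haveI := hP
  obtain ⟨n, u, w, h1, h2, h3, h4, h5, h6, h7⟩ := hdrop k₀ S f hd hf0 hf2 P hreg hfP hE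
  exact ⟨P, hP, hreg, hfP, fun 𝔭 _ _ => hι 𝔭, fun 𝔭 _ _ h𝔭 m => hJ 𝔭 h𝔭 m, n, u, w, h1, h2, h3, h4, h5, h6, h7⟩

/-- **GAP LIST OF RECORD for `stub_keyRungGrHomLE_three` — hD, hdrop.**  `KeyRungGrHomLE 3 p` from hD (desc-τ as typed; door-proved) and the
presentation-and-drop conjunct of hgame AT THE CANONICAL CENTRE (the top-`ι₀`-stratum prime): the centre half of hgame
(`exists_canonicalCentre_iotaFlatT`) and LEMMA C′ (…KeyRungThreeOfGame) are discharged. [OURS · L1 W4.3 · audit glue] -/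
theorem keyRungGrHomLE_three_of_drop (p : ℕ)
    (hD : ∀ (T T' : Type) [CommRing T] [IsRegularLocalRing T] [CommRing T'] [IsRegularLocalRing T'] [Algebra T T']
      [IsLocalHom (algebraMap T T')] [Algebra.FormallySmooth T T'] [Algebra.EssFiniteType T T'] (g : T),
      ringKrullDim T' ≤ 3 → IsTiePosition T' (algebraMap T T' g) → IsTiePosition T g)
    (hdrop : ∀ (k₀ : Type) [Field k₀] [CharP k₀ p] [PerfectField k₀]
      (S : Type) [CommRing S] [Algebra k₀ S] [Algebra.EssFiniteType k₀ S] [IsRegularLocalRing S]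
      (f : S), ringKrullDim S ≤ 3 → f ≠ 0 → f ∈ (maximalIdeal S) ^ 2 →
      ∀ (P : Ideal S) [P.IsPrime], IsRegularLocalRing (S ⧸ P) → f ∈ P →
        topStratum iotaOrdEpsTau S f = {𝔮 | P ≤ 𝔮.asIdeal} →
        ∃ (n : ℕ) (u : Fin n → S) (w : Fin n → ℕ),
          Ideal.span (Set.range u) = maximalIdeal S ∧ (maximalIdeal S).spanFinrank = n ∧ (∃ i, 0 < w i) ∧
          Ideal.span {x | ∃ i, 0 < w i ∧ x = u i} = P ∧
          (∀ m : ℕ, weightedMonomialIdeal u w m = jFlatT S f m) ∧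
          (∀ (Q : Ideal S) [Q.IsPrime], P ≤ Q →
            algebraMap S (Localization.AtPrime Q) f ∈ (maximalIdeal (Localization.AtPrime Q)) ^ 2) ∧
          WeightedDropHom iotaFlatT S f P u w) :
    KeyRungGrHomLE 3 p :=
  keyRungGrHomLE_three_of_game p hD (canonicalGameClauseHomLE_three_of_presentation p hdrop)

end Summit.ResolutionOfSingularities.ResolutionOfSingularities.Cruxes.HypersurfaceCentreConstruction.LocalEngine

end
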